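import Literature.Geometry.DiscreteGeometry.SphericalPolygonPerimeter
import Literature.Geometry.DiscreteGeometry.GirardSolidAngle
import HarnessLib

/-!
# The area of a convex spherical polygon is its excess (Girard for polygons) — proved:
# the solid angle of a convex polygonal cone is `Σ (dihedral angles) − (n − 2)π`

Topic `Literature/Geometry/DiscreteGeometry`; fourth brick on solid angles
(`SphericalWedgeVolume`, `DihedralAngleFraction`, `GirardSolidAngle`) and the companion of
`SphericalPolygonPerimeter.lean` (the perimeter of a convex spherical polygon is `< 2π`): for a
convex polygonal cone with apex `0` — edge rays `w 0, …, w (n−1) ∈ ℝ³`, `n ≥ 3`, with ALL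
CYCLICALLY ORDERED TRIPLES POSITIVELY ORIENTED (`det[w i; w j; w k] > 0` for `i < j < k`, the
same certificate of convexity as in `SphericalPolygonPerimeter.lean`) — the fraction of the unit
ball inside the cone is `(Σᵢ θᵢ − (n − 2)π)/4π`, `θᵢ` the dihedral angle along the edge `w i`;
equivalently (solid angle `= 4π ×` ball fraction, Hales 2012 §3.2) the AREA of the convex
spherical polygon with vertices `w i/‖w i‖` is the sum of its angles minus `(n − 2)π`.  This is
the per-face input of every Gauss–Bonnet / Euler-characteristic count on the sphere (Musin–Tarasov
2012 §3: faces of the contact graph; Hales 2012 Lemma 4.22).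

## What is proved

* Part O: more algebra of `orient3` — `orient3_three_term` (the Plücker relation
  `det[p;a;b] det[p;c;x] = det[p;c;b] det[p;a;x] + det[p;a;c] det[p;b;x]` among the facet
  functionals through a common edge), `linearIndependent_of_orient3_ne_zero`, linearity of
  `perpTo`, and the bridge to `GirardSolidAngle`: `orient3_mul_inner_triNormal`
  (`det[a;b;c] ⟪triNormal a b c, x⟫ = det[b;c;x] ‖triNormal a b c‖²`), `setOf_orient3_nonneg_eq`,
  **`setOf_orient3_inter₃_eq_apexCone`** (the trihedral cone in determinant form is
  `apexCone 0 ![a,b,c]`) and **`ballFraction_orient3_inter₃`** (Girard in determinant form).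
* Part Q: `polyCone n w = {x | ∀ i < n, det[w i; w (i+1 mod n); x] ≥ 0}`, `polyDih n w i` (the
  dihedral angle along `w i`), `ballFraction_union` (additivity over a null overlap),
  `volume_orient3_eq_zero` (facet planes are null), and the theorem
  **`ballFraction_polyCone`**: by induction on `n`, cutting along the plane through
  `w 0, w (n−2)` into `polyCone (n−1)` and the trihedral cone on `w 0, w (n−2), w (n−1)`
  (`hsplit`, from the three-term relation and the conic representation of the trihedral piece),
  which overlap in a null plane; the dihedral angles along the two cut edges add up
  (`angle_eq_angle_add_add_angle_add_of_mem_span`, the membership coming from `orient3_expand`).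
* Corollaries: `ballFraction_polyCone_apex` (any `n ≥ 3`, any apex), and
  `sub_two_mul_pi_le_sum_polyDih` (the excess is `≥ 0`).

No named facts.  Not here: that the facet cones of `conv X` (for `X ⊂ S²` finite, `0` interior)
tile the space — the global input that turns these per-face identities into Euler's formula.

## References

* T. C. Hales, *Dense Sphere Packings: a blueprint for formal proofs*, CUP 2012, §3.2 and
  Lemma 3.23. [`HalesDSP2012`]
* O. R. Musin, A. S. Tarasov, Discrete Comput. Geom. 48 (2012) 128–141, §3.1–3.2 (faces of the
  contact graph as convex spherical polygons). [`MusinTarasov2012`]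
-/

noncomputable section

namespace Literature.Geometry.DiscreteGeometry

open Real RealInnerProductSpace MeasureTheory Metric Set

/-! ### Part O. More algebra of `orient3` and `perpTo` -/

section OrientMore

local notation "E3" => EuclideanSpace ℝ (Fin 3)

/-- Linearity of `orient3` in the first argument (sums). [folklore] -/
theorem orient3_add_left (u u' v w : E3) :
    orient3 (u + u') v w = orient3 u v w + orient3 u' v w := by
  unfold orient3; simp only [PiLp.add_apply]; ring

/-- Linearity of `orient3` in the second argument (sums). [folklore] -/
theorem orient3_add_mid (u v v' w : E3) :
    orient3 u (v + v') w = orient3 u v w + orient3 u v' w := by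
  unfold orient3; simp only [PiLp.add_apply]; ring

/-- **The three-term (Plücker) relation** among the functionals `det[p; ·; ·]` through a common
vector `p`: `det[p;a;b] det[p;c;x] = det[p;c;b] det[p;a;x] + det[p;a;c] det[p;b;x]`.
[folklore] -/
theorem orient3_three_term (p a b c x : E3) :
    orient3 p a b * orient3 p c x =
      orient3 p c b * orient3 p a x + orient3 p a c * orient3 p b x := by
  unfold orient3; ring

/-- `orient3` vanishes when an argument is zero. [folklore] -/
@[simp] theorem orient3_zero_left (v w : E3) : orient3 0 v w = 0 := by
  unfold orient3; simp

/-- `orient3` vanishes when an argument is zero. [folklore] -/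
@[simp] theorem orient3_zero_mid (u w : E3) : orient3 u 0 w = 0 := by
  unfold orient3; simp

/-- `orient3` vanishes when an argument is zero. [folklore] -/
@[simp] theorem orient3_zero_right (u v : E3) : orient3 u v 0 = 0 := by
  unfold orient3; simp

/-- A nonzero determinant makes the three rows linearly independent. [folklore] -/
theorem linearIndependent_of_orient3_ne_zero {a b c : E3} (h : orient3 a b c ≠ 0) :
    LinearIndependent ℝ ![a, b, c] := by
  rw [Fintype.linearIndependent_iff]
  intro g hg i
  simp only [Fin.sum_univ_three, Matrix.cons_val_zero, Matrix.cons_val_one, Matrix.cons_val] at hg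
  have h0 : g 0 * orient3 a b c = 0 := by
    have := congrArg (fun z => orient3 z b c) hg
    simp only [orient3_add_left, orient3_smul_left, orient3_self_left, orient3_self_outer,
      mul_zero, add_zero, orient3_zero_left] at this
    exact this
  have h1 : g 1 * orient3 a b c = 0 := by
    have := congrArg (fun z => orient3 a z c) hg
    simp only [orient3_add_mid, orient3_smul_mid, orient3_self_left, orient3_self_right, mul_zero,
      zero_add, add_zero, orient3_zero_mid] at this
    exact this
  have h2 : g 2 * orient3 a b c = 0 := by
    have := congrArg (fun z => orient3 a b z) hg
    simp only [orient3_add_right, orient3_smul_right, orient3_self_outer, orient3_self_right,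
      mul_zero, zero_add, orient3_zero_right] at this
    exact this
  fin_cases i
  · exact (mul_eq_zero.1 h0).resolve_right h
  · exact (mul_eq_zero.1 h1).resolve_right h
  · exact (mul_eq_zero.1 h2).resolve_right h

/-- `perpTo a` is additive. [folklore] -/
theorem perpTo_add_right {F : Type*} [NormedAddCommGroup F] [InnerProductSpace ℝ F] (a x y : F) :
    perpTo a (x + y) = perpTo a x + perpTo a y := by
  simp only [perpTo, inner_add_right, add_div]
  module

/-- `perpTo a` is homogeneous. [folklore] -/
theorem perpTo_smul_right {F : Type*} [NormedAddCommGroup F] [InnerProductSpace ℝ F] (a x : F)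
    (c : ℝ) : perpTo a (c • x) = c • perpTo a x := by
  simp only [perpTo, inner_smul_right, mul_div_assoc]
  module

/-- `perpTo a a = 0`. [folklore] -/
theorem perpTo_self {F : Type*} [NormedAddCommGroup F] [InnerProductSpace ℝ F] (a : F) :
    perpTo a a = 0 := by
  rcases eq_or_ne a 0 with rfl | ha
  · simp [perpTo]
  · have : ⟪a, a⟫ ≠ 0 := fun h => ha (inner_self_eq_zero.1 h)
    rw [perpTo, div_self this, one_smul, sub_self]

/-- **The facet functionals and the facet normals agree in sign**:
`det[a;b;c] ⟪triNormal a b c, x⟫ = det[b;c;x] ‖triNormal a b c‖²`. [folklore] -/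
theorem orient3_mul_inner_triNormal (a b c x : E3) :
    orient3 a b c * ⟪triNormal a b c, x⟫ =
      orient3 b c x * ⟪triNormal a b c, triNormal a b c⟫ := by
  have h := congrArg (fun z => ⟪triNormal a b c, z⟫) (orient3_expand a b c x)
  simp only [inner_smul_right, inner_add_right] at h
  have hb : ⟪triNormal a b c, b⟫ = 0 := by rw [real_inner_comm]; exact inner_triNormal_fst a b c
  have hc : ⟪triNormal a b c, c⟫ = 0 := by rw [real_inner_comm]; exact inner_triNormal_snd a b c
  rw [hb, hc, mul_zero, mul_zero, add_zero, add_zero, inner_triNormal_self,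
    orient3_cyclic x b c] at h
  exact h

/-- Hence, for `det[a;b;c] > 0`, the facet half-space `det[b;c;·] ≥ 0` is
`⟪triNormal a b c, ·⟫ ≥ 0`.
[folklore] -/
theorem setOf_orient3_nonneg_eq {a b c : E3} (h : 0 < orient3 a b c) :
    {x : E3 | 0 ≤ orient3 b c x} = {x | 0 ≤ ⟪triNormal a b c, x⟫} := by
  have hm : 0 < ⟪triNormal a b c, triNormal a b c⟫ :=
    real_inner_self_pos.2 (triNormal_ne_zero (linearIndependent_of_orient3_ne_zero h.ne'))
  ext x
  simp only [Set.mem_setOf_eq]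
  have key := orient3_mul_inner_triNormal a b c x
  constructor
  · intro hx
    have : 0 ≤ orient3 a b c * ⟪triNormal a b c, x⟫ := by rw [key]; positivity
    exact nonneg_of_mul_nonneg_right this h
  · intro hx
    have : 0 ≤ orient3 b c x * ⟪triNormal a b c, triNormal a b c⟫ := by rw [← key]; positivity
    exact nonneg_of_mul_nonneg_left this hm

/-- **The trihedral cone in determinant form.**  For `det[a;b;c] > 0`, the intersection of the
three facet half-spaces `det[a;b;·] ≥ 0`, `det[b;c;·] ≥ 0`, `det[c;a;·] ≥ 0` is the cone
`apexCone 0 ![a, b, c]` spanned by `a, b, c`. [folklore] -/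
theorem setOf_orient3_inter₃_eq_apexCone {a b c : E3} (h : 0 < orient3 a b c) :
    {x : E3 | 0 ≤ orient3 b c x} ∩ {x | 0 ≤ orient3 c a x} ∩ {x | 0 ≤ orient3 a b x} =
      apexCone 0 ![a, b, c] := by
  have hli : LinearIndependent ℝ ![a, b, c] := linearIndependent_of_orient3_ne_zero h.ne'
  rw [apexCone_eq_inter₃ 0 ![a, b, c] hli]
  simp only [Matrix.cons_val_zero, Matrix.cons_val_one, Matrix.cons_val, sub_zero]
  have h1 : {x : E3 | 0 ≤ orient3 b c x} = {x | 0 ≤ ⟪triNormal a b c, x⟫} :=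
    setOf_orient3_nonneg_eq h
  have h2 : {x : E3 | 0 ≤ orient3 c a x} = {x | 0 ≤ ⟪triNormal b a c, x⟫} := by
    have h' : 0 < orient3 b c a := by rwa [← orient3_cyclic]
    have := setOf_orient3_nonneg_eq h'
    -- `triNormal b c a = triNormal b a c`
    rw [triNormal_comm] at this
    exact this
  have h3 : {x : E3 | 0 ≤ orient3 a b x} = {x | 0 ≤ ⟪triNormal c a b, x⟫} := by
    have h' : 0 < orient3 c a b := by rwa [orient3_cyclic]
    exact setOf_orient3_nonneg_eq h'
  rw [h1, h2, h3]

/-- … and its ball fraction is given by Girard's formula. [folklore] -/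
theorem ballFraction_orient3_inter₃ {a b c : E3} (h : 0 < orient3 a b c) :
    ballFraction (0 : E3)
        ({x : E3 | 0 ≤ orient3 b c x} ∩ {x | 0 ≤ orient3 c a x} ∩ {x | 0 ≤ orient3 a b x}) =
      (InnerProductGeometry.angle (perpTo a b) (perpTo a c) +
        InnerProductGeometry.angle (perpTo b a) (perpTo b c) +
        InnerProductGeometry.angle (perpTo c a) (perpTo c b) - π) / (4 * π) := by
  rw [setOf_orient3_inter₃_eq_apexCone h, ← solidAngleFraction,
    solidAngleFraction_eq_girard 0 ![a, b, c] (linearIndependent_of_orient3_ne_zero h.ne')]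
  simp

end OrientMore

/-! ### Part Q. Convex polygonal cones: the solid angle is the spherical excess -/

section PolyCone

local notation "E3" => EuclideanSpace ℝ (Fin 3)

open InnerProductGeometry Finset
open scoped NNReal

variable {E : Type*} [NormedAddCommGroup E] [InnerProductSpace ℝ E] [FiniteDimensional ℝ E]
  [MeasurableSpace E] [BorelSpace E]

/-- **Additivity of ball fractions** over two measurable pieces overlapping in a null set.
[folklore] -/
theorem ballFraction_union (v : E) {S T : Set E} (hT : MeasurableSet T)
    (hnull : volume (S ∩ T) = 0) :
    ballFraction v (S ∪ T) = ballFraction v S + ballFraction v T := by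
  simp only [ballFraction]
  have hadd := measure_union_add_inter (μ := volume) (ball v 1 ∩ S) (t := ball v 1 ∩ T)
    (measurableSet_ball.inter hT)
  have h0 : volume (ball v 1 ∩ S ∩ (ball v 1 ∩ T)) = 0 :=
    measure_mono_null (fun x hx => (⟨hx.1.2, hx.2.2⟩ : x ∈ S ∩ T)) hnull
  rw [h0, add_zero, ← Set.inter_union_distrib_left] at hadd
  have htop : volume (ball v (1 : ℝ)) ≠ ⊤ := measure_ball_lt_top.ne
  rw [hadd, ENNReal.toReal_add (measure_lt_top_of_subset inter_subset_left htop).ne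
    (measure_lt_top_of_subset inter_subset_left htop).ne, add_div]

/-- **The convex polygonal cone** with apex `0` and edge rays `w 0, …, w (n−1)` (indices mod `n`),
in facet form: the intersection of the `n` closed half-spaces `det[w i; w (i+1); ·] ≥ 0`.
[folklore] -/
def polyCone (n : ℕ) (w : ℕ → E3) : Set E3 :=
  {x | ∀ i, i < n → 0 ≤ orient3 (w i) (w ((i + 1) % n)) x}

/-- **The dihedral angle of the polygonal cone along the edge `w i`** (the angle of the
spherical polygon at its vertex `w i/‖w i‖`): the angle between the components of the two
neighbouring edges orthogonal to `w i`. [folklore] -/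
def polyDih (n : ℕ) (w : ℕ → E3) (i : ℕ) : ℝ :=
  angle (perpTo (w i) (w ((i + n - 1) % n))) (perpTo (w i) (w ((i + 1) % n)))

omit [FiniteDimensional ℝ E] [MeasurableSpace E] [BorelSpace E] in
/-- `x ↦ det[u; v; x]` is continuous. [folklore] -/
theorem continuous_orient3_right (u v : E3) : Continuous fun x => orient3 u v x :=
  (orient3Right u v).continuous_of_finiteDimensional

/-- A polygonal cone is closed … [folklore] -/
theorem isClosed_polyCone (n : ℕ) (w : ℕ → E3) : IsClosed (polyCone n w) := by
  have : polyCone n w = ⋂ i : Fin n, {x | 0 ≤ orient3 (w i) (w ((i + 1) % n)) x} := by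
    ext x
    simp only [polyCone, Set.mem_setOf_eq, Set.mem_iInter]
    exact ⟨fun h i => h i i.2, fun h i hi => h ⟨i, hi⟩⟩
  rw [this]
  exact isClosed_iInter fun i => isClosed_le continuous_const (continuous_orient3_right _ _)

/-- … hence measurable. [folklore] -/
theorem measurableSet_polyCone (n : ℕ) (w : ℕ → E3) : MeasurableSet (polyCone n w) :=
  (isClosed_polyCone n w).measurableSet

/-- A facet half-space is measurable. [folklore] -/
theorem measurableSet_orient3_nonneg (u v : E3) : MeasurableSet {x : E3 | 0 ≤ orient3 u v x} :=
  (isClosed_le continuous_const (continuous_orient3_right u v)).measurableSet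

/-- **The plane `det[a; b; ·] = 0` is a null set** when the functional is nonzero. [folklore] -/
theorem volume_orient3_eq_zero {a b c : E3} (h : orient3 a b c ≠ 0) :
    volume {x : E3 | orient3 a b x = 0} = 0 := by
  set n : E3 := (InnerProductSpace.toDual ℝ E3).symm
    (LinearMap.toContinuousLinearMap (orient3Right a b)) with hn
  have hnx : ∀ x, ⟪n, x⟫ = orient3 a b x := fun x => by
    rw [hn, InnerProductSpace.toDual_symm_apply]; rfl
  have hn0 : n ≠ 0 := by
    intro h0
    have := hnx c
    rw [h0, inner_zero_left] at this
    exact h this.symm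
  have hset : {x : E3 | orient3 a b x = 0} = {x | ⟪n, x⟫ = 0} := by
    ext x; rw [Set.mem_setOf_eq, Set.mem_setOf_eq, hnx]
  rw [hset]
  exact volume_inner_eq_zero hn0

/-- **The solid angle of a convex polygonal cone is its spherical excess** (Girard's theorem for
polygons): for `w 0, …, w (n−1) ∈ ℝ³` (`n ≥ 3`) with all cyclically ordered triples positively
oriented, the fraction of the unit ball inside `polyCone n w` is
`(Σᵢ polyDih n w i − (n − 2) π) / 4π` — i.e. the area of the convex spherical polygon with
vertices `w i/‖w i‖` is the sum of its angles minus `(n − 2)π`.  Proof by induction on `n`,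
cutting the cone along the plane through `w 0, w (n−2)` into the polygonal cone on
`w 0, …, w (n−2)` and the trihedral cone on `w 0, w (n−2), w (n−1)` (Girard,
`ballFraction_orient3_inter₃`), which overlap in a null plane; the dihedral angles along the
two cut edges add up (`angle_eq_angle_add_add_angle_add_of_mem_span`). [folklore] -/
theorem ballFraction_polyCone (m : ℕ) :
    ∀ w : ℕ → E3, (∀ i j k, i < j → j < k → k < m + 3 → 0 < orient3 (w i) (w j) (w k)) →
      ballFraction (0 : E3) (polyCone (m + 3) w) =
        ((∑ i ∈ range (m + 3), polyDih (m + 3) w i) - (m + 1) * π) / (4 * π) := by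
  induction m with
  | zero =>
    intro w hw
    have h012 := hw 0 1 2 (by omega) (by omega) (by omega)
    have hset : polyCone 3 w = {x : E3 | 0 ≤ orient3 (w 1) (w 2) x} ∩
        {x | 0 ≤ orient3 (w 2) (w 0) x} ∩ {x | 0 ≤ orient3 (w 0) (w 1) x} := by
      ext x
      simp only [polyCone, Set.mem_setOf_eq, Set.mem_inter_iff]
      constructor
      · intro h
        exact ⟨⟨by simpa using h 1 (by omega), by simpa using h 2 (by omega)⟩,
          by simpa using h 0 (by omega)⟩
      · rintro ⟨⟨h1, h2⟩, h0⟩ i hi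
        interval_cases i <;> simpa
    rw [hset, ballFraction_orient3_inter₃ h012]
    have e1 : polyDih 3 w 0 = angle (perpTo (w 0) (w 2)) (perpTo (w 0) (w 1)) := by
      simp [polyDih]
    have e2 : polyDih 3 w 1 = angle (perpTo (w 1) (w 0)) (perpTo (w 1) (w 2)) := by
      simp [polyDih]
    have e3 : polyDih 3 w 2 = angle (perpTo (w 2) (w 1)) (perpTo (w 2) (w 0)) := by
      simp [polyDih]
    rw [sum_range_succ, sum_range_succ, sum_range_succ, sum_range_zero, zero_add, e1, e2, e3,
      angle_comm (perpTo (w 0) (w 2)), angle_comm (perpTo (w 2) (w 1))]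
    norm_num
  | succ m ih =>
    intro w hw
    -- the pieces
    set Q := polyCone (m + 3) w with hQ
    set T := {x : E3 | 0 ≤ orient3 (w (m + 2)) (w (m + 3)) x} ∩
      {x | 0 ≤ orient3 (w (m + 3)) (w 0) x} ∩ {x | 0 ≤ orient3 (w 0) (w (m + 2)) x} with hT
    have hwQ : ∀ i j k, i < j → j < k → k < m + 3 → 0 < orient3 (w i) (w j) (w k) :=
      fun i j k hij hjk hk => hw i j k hij hjk (by omega)
    have hIH := ih w hwQ
    have hTpos : 0 < orient3 (w 0) (w (m + 2)) (w (m + 3)) := hw 0 (m + 2) (m + 3) (by omega)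
      (by omega) (by omega)
    have hTfrac := ballFraction_orient3_inter₃ hTpos
    -- cyclic variants of positivity
    have hcyc : ∀ i j k, i < j → j < k → k < m + 4 → 0 < orient3 (w j) (w k) (w i) := by
      intro i j k hij hjk hk; rw [← orient3_cyclic]; exact hw i j k hij hjk (by omega)
    have hcyc' : ∀ i j k, i < j → j < k → k < m + 4 → 0 < orient3 (w k) (w i) (w j) := by
      intro i j k hij hjk hk; rw [orient3_cyclic]; exact hw i j k hij hjk (by omega)
    -- membership characterisations
    have hP : ∀ x, x ∈ polyCone (m + 4) w ↔
        (∀ i, i ≤ m + 2 → 0 ≤ orient3 (w i) (w (i + 1)) x) ∧ 0 ≤ orient3 (w (m + 3)) (w 0) x := by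
      intro x
      simp only [polyCone, Set.mem_setOf_eq]
      constructor
      · intro h
        refine ⟨fun i hi => ?_, ?_⟩
        · have := h i (by omega)
          rwa [Nat.mod_eq_of_lt (by omega : i + 1 < m + 4)] at this
        · have := h (m + 3) (by omega)
          rwa [show m + 3 + 1 = m + 4 by ring, Nat.mod_self] at this
      · rintro ⟨h1, h2⟩ i hi
        rcases Nat.lt_or_ge i (m + 3) with hi' | hi'
        · rw [Nat.mod_eq_of_lt (by omega : i + 1 < m + 4)]; exact h1 i (by omega)
        · obtain rfl : i = m + 3 := by omega
          rwa [show m + 3 + 1 = m + 4 by ring, Nat.mod_self]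
    have hQ' : ∀ x, x ∈ Q ↔
        (∀ i, i ≤ m + 1 → 0 ≤ orient3 (w i) (w (i + 1)) x) ∧ 0 ≤ orient3 (w (m + 2)) (w 0) x := by
      intro x
      simp only [hQ, polyCone, Set.mem_setOf_eq]
      constructor
      · intro h
        refine ⟨fun i hi => ?_, ?_⟩
        · have := h i (by omega)
          rwa [Nat.mod_eq_of_lt (by omega : i + 1 < m + 3)] at this
        · have := h (m + 2) (by omega)
          rwa [show m + 2 + 1 = m + 3 by ring, Nat.mod_self] at this
      · rintro ⟨h1, h2⟩ i hi
        rcases Nat.lt_or_ge i (m + 2) with hi' | hi'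
        · rw [Nat.mod_eq_of_lt (by omega : i + 1 < m + 3)]; exact h1 i (by omega)
        · obtain rfl : i = m + 2 := by omega
          rwa [show m + 2 + 1 = m + 3 by ring, Nat.mod_self]
    have hT' : ∀ x, x ∈ T ↔ 0 ≤ orient3 (w (m + 2)) (w (m + 3)) x ∧
        0 ≤ orient3 (w (m + 3)) (w 0) x ∧ 0 ≤ orient3 (w 0) (w (m + 2)) x := by
      intro x; simp only [hT, Set.mem_inter_iff, Set.mem_setOf_eq, and_assoc]
    -- (S1) the decomposition
    have hsplit : polyCone (m + 4) w = Q ∪ T := by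
      ext x
      rw [Set.mem_union, hP, hQ', hT']
      constructor
      · rintro ⟨h1, h2⟩
        rcases le_or_gt 0 (orient3 (w 0) (w (m + 2)) x) with hD | hD
        · exact Or.inr ⟨h1 (m + 2) le_rfl, h2, hD⟩
        · refine Or.inl ⟨fun i hi => h1 i (by omega), ?_⟩
          rw [orient3_swap_left]; linarith
      · rintro (⟨h1, h2⟩ | ⟨h1, h2, h3⟩)
        · -- `Q ⊆ P`
          have hD : orient3 (w 0) (w (m + 2)) x ≤ 0 := by
            rw [orient3_swap_left] at h2; linarith
          refine ⟨fun i hi => ?_, ?_⟩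
          · rcases Nat.lt_or_ge i (m + 2) with hi' | hi'
            · exact h1 i (by omega)
            · obtain rfl : i = m + 2 := by omega
              -- three-term relation at `p = w (m+2)` with `a = w 0`, `b = w (m+1)`, `c = w (m+3)`
              have h3t := orient3_three_term (w (m + 2)) (w 0) (w (m + 1)) (w (m + 3)) x
              have s1 : 0 < orient3 (w (m + 2)) (w 0) (w (m + 1)) :=
                hcyc' 0 (m + 1) (m + 2) (by omega) (by omega) (by omega)
              have s2 : 0 < orient3 (w (m + 2)) (w (m + 3)) (w (m + 1)) :=
                hcyc (m + 1) (m + 2) (m + 3) (by omega) (by omega) (by omega)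
              have s3 : orient3 (w (m + 2)) (w 0) (w (m + 3)) < 0 := by
                rw [orient3_cyclic, orient3_swap_right]
                linarith [hTpos]
              have s4 : orient3 (w (m + 2)) (w (m + 1)) x ≤ 0 := by
                rw [orient3_swap_left]; linarith [h1 (m + 1) le_rfl]
              have : 0 ≤ orient3 (w (m + 2)) (w 0) (w (m + 1)) *
                  orient3 (w (m + 2)) (w (m + 3)) x := by
                rw [h3t]
                exact add_nonneg (mul_nonneg s2.le h2) (mul_nonneg_of_nonpos_of_nonpos s3.le s4)
              exact nonneg_of_mul_nonneg_right this s1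
          · -- `det[w(m+3); w 0; x] ≥ 0`, from the three-term relation at `p = w 0`
            have h3t := orient3_three_term (w 0) (w 1) (w (m + 2)) (w (m + 3)) x
            have s1 : 0 < orient3 (w 0) (w 1) (w (m + 2)) := hw 0 1 (m + 2) (by omega) (by omega)
              (by omega)
            have s2 : orient3 (w 0) (w (m + 3)) (w (m + 2)) < 0 := by
              rw [orient3_swap_right]; linarith [hTpos]
            have s3 : 0 < orient3 (w 0) (w 1) (w (m + 3)) := hw 0 1 (m + 3) (by omega) (by omega)
              (by omega)
            have s4 : 0 ≤ orient3 (w 0) (w 1) x := h1 0 (by omega)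
            have : orient3 (w 0) (w 1) (w (m + 2)) * orient3 (w 0) (w (m + 3)) x ≤ 0 := by
              rw [h3t]
              exact add_nonpos (mul_nonpos_of_nonpos_of_nonneg s2.le s4)
                (mul_nonpos_of_nonneg_of_nonpos s3.le hD)
            have h03 : orient3 (w 0) (w (m + 3)) x ≤ 0 := by
              by_contra hcon
              push Not at hcon
              have := mul_pos s1 hcon
              linarith
            rw [orient3_cyclic, orient3_swap_right]
            linarith
        · -- `T ⊆ P`: write `x` as a nonnegative combination of `w 0, w (m+2), w (m+3)`
          have hxT : x ∈ apexCone (0 : E3) ![w 0, w (m + 2), w (m + 3)] := by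
            rw [← setOf_orient3_inter₃_eq_apexCone hTpos]
            exact ⟨⟨h1, h2⟩, h3⟩
          obtain ⟨c, hc, hxc⟩ := hxT
          simp only [Fin.sum_univ_three, Matrix.cons_val_zero, Matrix.cons_val_one, Matrix.cons_val,
            zero_add] at hxc
          -- every facet functional is `≥ 0` on every edge
          have hfac : ∀ i j, i ≤ m + 2 → j < m + 4 → 0 ≤ orient3 (w i) (w (i + 1)) (w j) := by
            intro i j hi hj
            rcases Nat.lt_trichotomy j i with hji | rfl | hji
            · exact (hcyc j i (i + 1) hji (by omega) (by omega)).le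
            · simp
            · rcases Nat.lt_or_ge (j) (i + 2) with hji' | hji'
              · obtain rfl : j = i + 1 := by omega
                simp
              · exact (hw i (i + 1) j (by omega) (by omega) hj).le
          have hfac' : ∀ j, j < m + 4 → 0 ≤ orient3 (w (m + 3)) (w 0) (w j) := by
            intro j hj
            rcases Nat.eq_zero_or_pos j with rfl | hj0
            · simp
            · rcases Nat.lt_or_ge j (m + 3) with hj' | hj'
              · exact (hcyc' 0 j (m + 3) hj0 hj' (by omega)).le
              · obtain rfl : j = m + 3 := by omega
                simp
          refine ⟨fun i hi => ?_, ?_⟩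
          · rw [hxc]
            simp only [orient3_add_right, orient3_smul_right]
            exact add_nonneg (add_nonneg (mul_nonneg (hc 0) (hfac i 0 hi (by omega)))
              (mul_nonneg (hc 1) (hfac i (m + 2) hi (by omega))))
              (mul_nonneg (hc 2) (hfac i (m + 3) hi (by omega)))
          · rw [hxc]
            simp only [orient3_add_right, orient3_smul_right]
            exact add_nonneg (add_nonneg (mul_nonneg (hc 0) (hfac' 0 (by omega)))
              (mul_nonneg (hc 1) (hfac' (m + 2) (by omega))))
              (mul_nonneg (hc 2) (hfac' (m + 3) (by omega)))
    -- (S2) the overlap is a null plane; (S3) additivity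
    have hnull : volume (Q ∩ T) = 0 := by
      refine measure_mono_null (fun x hx => ?_) (volume_orient3_eq_zero hTpos.ne')
      have hq := ((hQ' x).1 hx.1).2
      have ht := ((hT' x).1 hx.2).2.2
      rw [orient3_swap_left] at hq
      simp only [Set.mem_setOf_eq]
      linarith
    have hTmeas : MeasurableSet T :=
      ((measurableSet_orient3_nonneg _ _).inter (measurableSet_orient3_nonneg _ _)).inter
        (measurableSet_orient3_nonneg _ _)
    have hfrac : ballFraction (0 : E3) (polyCone (m + 4) w) =
        ballFraction (0 : E3) Q + ballFraction (0 : E3) T := by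
      rw [hsplit]
      exact ballFraction_union 0 hTmeas hnull
    -- (S4) the dihedral angles
    have hmod : ∀ n a : ℕ, a < n → (a + n) % n = a := fun n a ha => by
      rw [Nat.add_mod_right, Nat.mod_eq_of_lt ha]
    -- nonvanishing of the projections used for additivity
    have hp02 : perpTo (w 0) (w (m + 2)) ≠ 0 := by
      intro h0
      have e : w (m + 2) = (⟪w 0, w (m + 2)⟫ / ⟪w 0, w 0⟫) • w 0 := by
        rw [← sub_eq_zero]; exact h0
      have h' : 0 < orient3 (w 0) ((⟪w 0, w (m + 2)⟫ / ⟪w 0, w 0⟫) • w 0) (w (m + 3)) := by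
        rw [← e]; exact hTpos
      rw [orient3_smul_mid, orient3_self_left, mul_zero] at h'
      exact lt_irrefl _ h'
    have hp20 : perpTo (w (m + 2)) (w 0) ≠ 0 := by
      intro h0
      have e : w 0 = (⟪w (m + 2), w 0⟫ / ⟪w (m + 2), w (m + 2)⟫) • w (m + 2) := by
        rw [← sub_eq_zero]; exact h0
      have h' : 0 < orient3 ((⟪w (m + 2), w 0⟫ / ⟪w (m + 2), w (m + 2)⟫) • w (m + 2)) (w (m + 2))
          (w (m + 3)) := by
        rw [← e]; exact hTpos
      rw [orient3_smul_left, orient3_self_left, mul_zero] at h'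
      exact lt_irrefl _ h'
    -- memberships in planar cones, from `orient3_expand`
    have hmem : ∀ p a b c : E3, 0 < orient3 p a b → 0 ≤ orient3 p c b → 0 ≤ orient3 p a c →
        perpTo p c ∈ Submodule.span ℝ≥0 {perpTo p a, perpTo p b} := by
      intro p a b c hΔ hb ha
      have hexp := congrArg (perpTo p) (orient3_expand p a b c)
      rw [perpTo_smul_right, perpTo_add_right, perpTo_add_right, perpTo_smul_right,
        perpTo_smul_right, perpTo_smul_right, perpTo_self, smul_zero, zero_add] at hexp
      rw [Submodule.mem_span_pair]
      refine ⟨Real.toNNReal (orient3 p c b / orient3 p a b),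
        Real.toNNReal (orient3 p a c / orient3 p a b), ?_⟩
      simp only [NNReal.smul_def, Real.coe_toNNReal _ (div_nonneg hb hΔ.le),
        Real.coe_toNNReal _ (div_nonneg ha hΔ.le)]
      rw [div_eq_inv_mul, div_eq_inv_mul, mul_smul, mul_smul, ← smul_add, ← hexp, smul_smul,
        inv_mul_cancel₀ hΔ.ne', one_smul]
    have hA0 : angle (perpTo (w 0) (w (m + 3))) (perpTo (w 0) (w 1)) =
        angle (perpTo (w 0) (w (m + 3))) (perpTo (w 0) (w (m + 2))) +
          angle (perpTo (w 0) (w (m + 2))) (perpTo (w 0) (w 1)) := by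
      refine angle_eq_angle_add_add_angle_add_of_mem_span hp02 ?_
      rw [Set.pair_comm]
      exact hmem (w 0) (w 1) (w (m + 3)) (w (m + 2))
        (hw 0 1 (m + 3) (by omega) (by omega) (by omega))
        hTpos.le (hw 0 1 (m + 2) (by omega) (by omega) (by omega)).le
    have hA2 : angle (perpTo (w (m + 2)) (w (m + 1))) (perpTo (w (m + 2)) (w (m + 3))) =
        angle (perpTo (w (m + 2)) (w (m + 1))) (perpTo (w (m + 2)) (w 0)) +
          angle (perpTo (w (m + 2)) (w 0)) (perpTo (w (m + 2)) (w (m + 3))) := by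
      refine angle_eq_angle_add_add_angle_add_of_mem_span hp20 ?_
      rw [Set.pair_comm]
      exact hmem (w (m + 2)) (w (m + 3)) (w (m + 1)) (w 0)
        (hcyc (m + 1) (m + 2) (m + 3) (by omega) (by omega) (by omega))
        (hcyc' 0 (m + 1) (m + 2) (by omega) (by omega) (by omega)).le
        (hcyc 0 (m + 2) (m + 3) (by omega) (by omega) (by omega)).le
    -- the values of `polyDih`
    have f0 : polyDih (m + 4) w 0 = angle (perpTo (w 0) (w (m + 3))) (perpTo (w 0) (w 1)) := by
      rw [polyDih, show 0 + (m + 4) - 1 = m + 3 by omega, Nat.mod_eq_of_lt (by omega),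
        Nat.mod_eq_of_lt (by omega)]
    have fmid : ∀ i, i < m + 1 → polyDih (m + 4) w (i + 1) =
        angle (perpTo (w (i + 1)) (w i)) (perpTo (w (i + 1)) (w (i + 2))) := by
      intro i hi
      rw [polyDih, show i + 1 + (m + 4) - 1 = i + (m + 4) by omega, hmod _ _ (by omega),
        Nat.mod_eq_of_lt (by omega)]
    have fm2 : polyDih (m + 4) w (m + 2) =
        angle (perpTo (w (m + 2)) (w (m + 1))) (perpTo (w (m + 2)) (w (m + 3))) := by
      rw [polyDih, show m + 2 + (m + 4) - 1 = (m + 1) + (m + 4) by omega, hmod _ _ (by omega),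
        Nat.mod_eq_of_lt (by omega)]
    have fm3 : polyDih (m + 4) w (m + 3) =
        angle (perpTo (w (m + 3)) (w (m + 2))) (perpTo (w (m + 3)) (w 0)) := by
      rw [polyDih, show m + 3 + (m + 4) - 1 = (m + 2) + (m + 4) by omega, hmod _ _ (by omega),
        show m + 3 + 1 = m + 4 by ring, Nat.mod_self]
    have g0 : polyDih (m + 3) w 0 = angle (perpTo (w 0) (w (m + 2))) (perpTo (w 0) (w 1)) := by
      rw [polyDih, show 0 + (m + 3) - 1 = m + 2 by omega, Nat.mod_eq_of_lt (by omega),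
        Nat.mod_eq_of_lt (by omega)]
    have gmid : ∀ i, i < m + 1 → polyDih (m + 3) w (i + 1) =
        angle (perpTo (w (i + 1)) (w i)) (perpTo (w (i + 1)) (w (i + 2))) := by
      intro i hi
      rw [polyDih, show i + 1 + (m + 3) - 1 = i + (m + 3) by omega, hmod _ _ (by omega),
        Nat.mod_eq_of_lt (by omega)]
    have gm2 : polyDih (m + 3) w (m + 2) =
        angle (perpTo (w (m + 2)) (w (m + 1))) (perpTo (w (m + 2)) (w 0)) := by
      rw [polyDih, show m + 2 + (m + 3) - 1 = (m + 1) + (m + 3) by omega, hmod _ _ (by omega),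
        show m + 2 + 1 = m + 3 by ring, Nat.mod_self]
    -- the two sums
    have hsumf : ∑ i ∈ range (m + 4), polyDih (m + 4) w i =
        polyDih (m + 4) w 0 + ∑ i ∈ range (m + 1), polyDih (m + 4) w (i + 1) +
          polyDih (m + 4) w (m + 2) + polyDih (m + 4) w (m + 3) := by
      rw [sum_range_succ, sum_range_succ, sum_range_succ']
      ring
    have hsumg : ∑ i ∈ range (m + 3), polyDih (m + 3) w i =
        polyDih (m + 3) w 0 + ∑ i ∈ range (m + 1), polyDih (m + 3) w (i + 1) +
          polyDih (m + 3) w (m + 2) := by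
      rw [sum_range_succ, sum_range_succ']
      ring
    have hmid : ∑ i ∈ range (m + 1), polyDih (m + 4) w (i + 1) =
        ∑ i ∈ range (m + 1), polyDih (m + 3) w (i + 1) :=
      sum_congr rfl fun i hi => by rw [fmid i (mem_range.1 hi), gmid i (mem_range.1 hi)]
    -- assemble
    show ballFraction (0 : E3) (polyCone (m + 4) w) =
      ((∑ i ∈ range (m + 4), polyDih (m + 4) w i) - ((m + 1 : ℕ) + 1) * π) / (4 * π)
    rw [hfrac, hIH, hTfrac, hsumf, hsumg, hmid, f0, fm2, fm3, g0, gm2, hA0, hA2,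
      angle_comm (perpTo (w (m + 3)) (w (m + 2))) (perpTo (w (m + 3)) (w 0)),
      angle_comm (perpTo (w 0) (w (m + 3))) (perpTo (w 0) (w (m + 2)))]
    push_cast
    ring

end PolyCone

section Corollaries

local notation "E3" => EuclideanSpace ℝ (Fin 3)

open InnerProductGeometry Finset

/-- The same for any `n ≥ 3` and any apex `v`: the fraction of the unit ball at `v` inside the
translated cone `{x | x − v ∈ polyCone n w}` is `(Σᵢ polyDih n w i − (n − 2)π)/4π`. [folklore] -/
theorem ballFraction_polyCone_apex {n : ℕ} (hn : 3 ≤ n) (v : E3) (w : ℕ → E3)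
    (hw : ∀ i j k, i < j → j < k → k < n → 0 < orient3 (w i) (w j) (w k)) :
    ballFraction v {x | x - v ∈ polyCone n w} =
      ((∑ i ∈ range n, polyDih n w i) - (n - 2) * π) / (4 * π) := by
  obtain ⟨m, rfl⟩ : ∃ m, n = m + 3 := ⟨n - 3, by omega⟩
  rw [ballFraction_setOf_sub_mem, ballFraction_polyCone m w hw]
  push_cast
  ring

/-- **The spherical excess of a convex spherical polygon is positive … at least nonnegative**:
`Σᵢ polyDih n w i ≥ (n − 2)π` (from `ballFraction ≥ 0`).  Together with
`sum_angle_lt_two_pi_of_orient3_pos` (perimeter `< 2π`) these are the two classical inequalities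
for convex spherical polygons. [folklore] -/
theorem sub_two_mul_pi_le_sum_polyDih {n : ℕ} (hn : 3 ≤ n) (w : ℕ → E3)
    (hw : ∀ i j k, i < j → j < k → k < n → 0 < orient3 (w i) (w j) (w k)) :
    (n - 2) * π ≤ ∑ i ∈ range n, polyDih n w i := by
  have h := ballFraction_polyCone_apex hn 0 w hw
  have h0 : 0 ≤ ballFraction (0 : E3) {x | x - 0 ∈ polyCone n w} := ballFraction_nonneg _ _
  rw [h] at h0
  have hπ : 0 < π := Real.pi_pos
  have := mul_nonneg h0 (by positivity : (0 : ℝ) ≤ 4 * π)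
  rw [div_mul_cancel₀ _ (by positivity)] at this
  linarith

end Corollaries

end Literature.Geometry.DiscreteGeometry

end
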